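import Mathlib
import HarnessLib
import HarnessLib.Audit
import Summits.ABC.Statement
import Literature.NumberTheory.DiophantineGeometry.Conductor
import Literature.NumberTheory.DiophantineGeometry.MinimalDiscriminant
import HarnessLib.Audit.Status.Attr

/-!
Route: CuspFieldPencil

# Route CuspFieldPencil — Szpiro exponent 1/2 on the rational 5-torsion class via the cusp pencil of
X₁(5) over its cusp field ℚ(√5)

CLASS THEOREM, NOT abc, NOT A-PS, no rung proved: on the rational-5-torsion class 𝒯₅ = {W(u,w) =
⟨w−u, −uw, −uw², 0, 0⟩ : u,w ∈ ℤ coprime, uw(u²−11uw−w²) ≠ 0} (the Tate normal form E(t,t), t = u/w;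
every E/ℚ with a rational point of order 5 is ℚ-isomorphic to some W(u,w)) it suffices to show the
GOLDEN CUSP SHADOW X1 = `GoldenCuspShadow`: for every ε > 0, log max(|u|,|w|) ≤ κ_ε ·
rad(u·w·(u²−11uw−w²))^{1/2+ε}. With the provable dictionary (Δ(W) = u⁵w⁵(u²−11uw−w²) identically;
every prime p ≠ 5 of u·w·(u²−11uw−w²) is multiplicative for W, so rad ∣ 5·N_W) this gives the class
ε-shape `FiveTorsionClassEpsShape`: log|Δ_min(W)| ≤ C_ε·N_W^{1/2+ε} for every W ∈ 𝒯₅ — below the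
all-E record exponent 1 on a class the rational-cusp pencils cannot reach. The deciding theorem
reaches `_root_.ABC` only through the DECLARED RESIDUAL `FiveTorsionResidual` (abc-strength, never
staffed).
Lean: `GoldenCuspShadow → FiveTorsionDictionary → FiveTorsionPayoff → FiveTorsionResidual →
_root_.ABC`

## Assembly
Pure logic: `closes (h₁ : GoldenCuspShadow) (h₂ : FiveTorsionDictionary) (h₃ : FiveTorsionPayoff)
(h₄ : FiveTorsionResidual) : _root_.ABC := h₄ (h₃ h₁ h₂)`. Load-bearing open cruxes: X1 (rank 2) and
the declared residual (rank 3); dictionary and payoff are provable now. HONESTY: no summit and no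
rung is proved by this line; the mathematics of the line ends at the class theorem
`FiveTorsionClassEpsShape`; typed ≠ proved.

Rationale: WHY THIS LINE. Mechanism (extremal-example mining, KEY IDEA-OPPOSITE-EXTREMAL): the Szpiro-ratio
record tables are populated by torsion/isogeny families whose discriminant carries a forced cusp
multiplicity — for 5-torsion Δ = t⁵(t²−11t−1) in the Hauptmodul t of X₁(5); the OPPOSITE statement
is that the same cusp structure caps the class. X₁(5) has four cusps: two rational (t = 0, ∞ ↦ the
forms u, w) and two conjugate over the cusp field K = ℚ(√5) = ℚ(ζ₅)⁺ (t²−11t−1 = (t−φ⁵)(t+φ⁻⁵), φ =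
(1+√5)/2, φ⁵ = 3+5φ ∈ 𝓞_K), so over K the binary form u·w·(u²−11uw−w²) SPLITS into four linear cusp
forms u, w, x₊ = u−φ⁵w, x₋ = u+φ⁻⁵w, any three of which satisfy a unit- /constant-coefficient 3-term
identity (u − x₊ = φ⁵w; x₋ − x₊ = 5√5·w; φ⁻⁵x₊ + φ⁵x₋ = 5√5·u) — a pencil of S-unit equations over a
FIXED class-number-one field. IMPORT (unit equations / LFL over number fields): Scoones,
arXiv:2111.07791 Thm 3 and its final corollary log H_L(a,b,c) < G^{1/3 + C·log₃G/log₂G} for a+b+c =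
0 in 𝓞_K pairwise coprime, G = ∏_{𝔓∣abc} N𝔓 over the Hilbert class field L, constants depending on K
only [corpus: paper-arxiv-2111.07791 p.3 (set-up), p.4 (Thms 1–3)]; h(ℚ(√5)) = 1 so L = K and
nothing varies with the curve. ARITHMETIC OF THE SAVING: an inert prime divides neither x₊ nor x₋
(x₊ = (u−3w) − 5wφ, so p ∣ x₊ in 𝓞_K forces p ∣ gcd(u,w)); a split p ∣ u²−11uw−w² puts exactly one
of 𝔭, 𝔭̄ into x₊ and the other into x₋ (norm p each), while a rational member u or w costs p² in G;
hence G(u,w,x₊) ≈ rad(u)²rad(w)²rad(Q), G(x₊,x₋,w) ≈ 5·rad(Q)²rad(w)², G(x₊,x₋,u) ≈ 5·rad(Q)²rad(u)²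
(Q = u²−11uw−w²), and the minimum over the three triples of G^{1/3} is ≤ rad(uwQ)^{1/2} exactly
(worst case rad u = rad w = R^{1/4}, rad Q = R^{1/2}; elementary: min(x²y²z, z²y², z²x²) ≤
(xyz)^{3/2}). WHAT IT DOES THAT LISTED ROUTES DO NOT: route-ABC-RationalCuspPencil / TwoSixPencil
need k ≥ 3 RATIONAL cusps (their class list: ℤ/4, ℤ/6, ℤ/7, ℤ/8, ℤ/9, ℤ/10, ℤ/12, ℤ/2×ℤ/2n — ℤ/5 is
absent: over ℚ the cusp quadratic Q only enters the 4-term identity u² − 11uw − w² − Q = 0,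
subspace-theorem territory, ineffective); route-ABC-GaussianTwoDivision fixes the 2-DIVISION field
ℚ(i) on the sub-class a²−4b = −n² (exponent 2/3); route-ABC-TwoTorsionFieldEconomy (this seat, LINE
1) lets the 2-division field vary and pays class numbers. Here the number field is the field of
definition of the CUSPS, fixed once per modular curve, and for every genus-0 X₁(N)/X₀(N) it is a
class-number-one cyclotomic field — the lever «irrational cusps are free over the cusp field» opens
every torsion/isogeny class with ≥ 3 cusps over ℚ̄, not ≥ 3 over ℚ (further rows, untyped: X₀(9)
over ℚ(√−3): 1/2; X₀(25) over ℚ(ζ₅): < 1). Honest comparison with print: on the INTEGRAL slices w =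
±1 / u = ±1 Cuevas Barrientos–Pasten arXiv:2504.15971 Thm 1.1/Cor 1.2 already give log|Δ| ≪_ε N^ε
(modular method + LFL, integer parameter only) [corpus: paper-arxiv-2504.15971 p.3]; on the
two-parameter class (t = u/w ∈ ℚ) the record is the all-E exponent 1 (Murty–Pasten). Sources:
arXiv:2111.07791, StewartYu2001, Kubert1976, arXiv:2504.15971, arXiv:2407.13850, MurtyPasten2013.

RANKED CRUXES. #0 FiveTorsionClassEpsShape (target) — for every ε > 0 there is C such that for all
coprime integers u, w with uw(u²−11uw−w²) ≠ 0 and every elliptic W/ℚ equal to ⟨w−u, −uw, −uw², 0,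
0⟩: log|Δ_min(W)| ≤ C·N_W^{1/2+ε}. A class theorem on the rational-5-torsion class (NOT abc, NOT
A-PS, NOT the all-E rung SzpiroExponentBelowOne). (why it might fail: it fails only if X1 fails; abc
(indeed Szpiro with any exponent) implies it, so falsity would refute abc on 𝒯₅ — the risk is that
the cusp-field engine delivers only 2/3 (conjugate-cusp triples unusable), not falsity.)
[arXiv:2111.07791, arXiv:2407.13850, MurtyPasten2013]
#2 GoldenCuspShadow (crux) — X1, the ℤ-shadow of Scoones' number-field Stewart–Yu over the cusp
field ℚ(√5) run on the three cusp triples of X₁(5) and minimised: for every ε > 0 there is κ with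
log max(|u|,|w|) ≤ κ · rad(u·w·(u²−11uw−w²))^{1/2+ε} for all coprime integers u, w with
uw(u²−11uw−w²) ≠ 0 — abc with exponent 1/2 inside the exponential for ONE binary quartic form, the
norm form of the cusps of X₁(5). [difficulty: L] (why it might fail: Scoones' corollary wants
pairwise-coprime 𝓞_K-triples under her relabeling; the conjugate-cusp triples (x₊, x₋, 5√5·w) share
√5 when 5 ∣ Q and carry the constant 5√5 — if only the unit-coefficient triples (u, φ⁵w, x₊)
qualify, the exponent degrades to 2/3 (not to nothing).) [arXiv:2111.07791, StewartYu2001,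
EvertseGyory2015, Kubert1976]
#3 FiveTorsionResidual (crux) — DECLARED RESIDUAL (abc-strength by construction, never staffed as
mathematics of this line): abc given the class theorem on 𝒯₅. Booked so that `closes` reaches the
registered Statement decl; to be narrowed by name to any registered all-E rung the class theorem
feeds (none exists today: `SzpiroExponentBelowOne` is not a registered closer). [deps:
FiveTorsionClassEpsShape] [difficulty: open-problem] (why it might fail: it is abc-hard (equivalent
to abc given the class theorem); it fails exactly if abc fails — declared residual, not a claim of
this line.) [PastenShimura2024, Literature.Abc.ABCConjecture]
#9 FiveTorsionDictionary (support) — for coprime u, w with uw(u²−11uw−w²) ≠ 0 and W = ⟨w−u, −uw,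
−uw², 0, 0⟩ elliptic: |Δ_min(W)| ≤ |u⁵w⁵(u²−11uw−w²)| (W is an integral model and Δ(W) =
u⁵w⁵(u²−11uw−w²) identically — checked symbolically/numerically) and rad(u·w·(u²−11uw−w²)) ∣ 5·N_W
(for p ≠ 5 dividing a cusp form, p ∤ c₄(W) = u⁴−12u³w+14u²w²+12uw³+w⁴ since c₄ ≡ w⁴ mod u, ≡ u⁴ mod
w and Res_t(c₄, t²−11t−1) = 25; so W is p-minimal with multiplicative reduction — Tate's algorithm,
pattern of `twoTorsionDictionary_proof` / `RationalCuspPencilSixTorsionDictionary`). [difficulty: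
provable-now] [Silverman2009, Kubert1976, stmt-ABC-23398]
#9 FiveTorsionPayoff (support) — X1 + dictionary ⇒ target: log|Δ_min| ≤ log|u⁵w⁵Q| ≤ 12·log
max(|u|,|w|) + log 13 ≤ 12κ·rad(uwQ)^{1/2+ε} + log 13 ≤ 12κ·(5N)^{1/2+ε} + log 13 ≤ C·N^{1/2+ε} (N ≥
1; real arithmetic with Real.log / rpow monotonicity, Nat casts of the divisibility rad ∣ 5N).
[difficulty: provable-now] [Silverman2009, stmt-ABC-23398]

TWO-LAYER PLAN. X1 ⇐ K2a ∧ K2b (the registered birth skeleton): K2a `stub_splitCuspTriple` — Scoones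
over ℚ(√5) on the unit-coefficient triple x₊ + φ⁵w − u = 0: log max(|u|,|w|) ≤ κ·rad(uwQ)^ε·(rad
u·rad w)^{2/3}·rad(Q)^{1/3} (alone: exponent 2/3 on the class); K2b `stub_conjugateCuspTriple` —
Scoones on the conjugate-cusp triples x₋ − x₊ = 5√5·w and φ⁻⁵x₊ + φ⁵x₋ = 5√5·u after dividing out
the bounded common √5-part: log max(|u|,|w|) ≤ κ·rad(uwQ)^ε·rad(Q)^{2/3}·min(rad u, rad w)^{2/3};
composition (kernel-checked): min(x^{2/3}y^{2/3}z^{1/3}, z^{2/3}min(x,y)^{2/3}) ≤ (xyz)^{1/2}. Below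
that (provers, `--supports`): the cusp-field Literature fact `Scoones2021_cor_G13` over a fixed
number field (SHARED want with route-ABC-GaussianTwoDivision, K = ℚ(i) there, ℚ(√5) here — one
typing serves both), the prime-splitting lemma for x± in ℤ[φ], and heights of (u : w)-linear forms
over a real quadratic field vs log max(|u|,|w|).

KILL CRITERIA. Refutation of X1 as typed (a coprime family (u,w) with log
max(|u|,|w|)/rad(uwQ)^{1/2+ε} unbounded) closes the route `refuted:GoldenCuspShadow` — such a family
would refute abc for the binary form uwQ, so the realistic kill is METHOD-LEVEL: Scoones' hypotheses
failing for the conjugate-cusp triples AND for the unit triple (then nothing below the all-E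
exponent 1 survives and the route closes `exhausted` with the fold «B-CUSPFIELD: which cusp triples
over K are admissible»); if only the conjugate triples fail, X1 is restated at 2/3 (stub K2a alone)
— still below the record 1, still a row.

NOT DECOMPOSED YET. The number-field layer (heights H_K on 𝓞_K-triples, G over K, Scoones' corollary
as a named Literature fact with its side conditions, the ℤ[φ]-splitting lemma) is deliberately NOT
typed at open: Mathlib has `NumberField`, `𝓞 K`, `Zsqrtd`/quadratic integer rings and
`IsDedekindDomain.HeightOneSpectrum`, but no Weil-height API on 𝓞_K convenient for H_K(a,b,c);
typing it is shared work with route-ABC-GaussianTwoDivision (same fact, K = ℚ(i)) and is done when a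
prover claims X1. The sharper Scoones Thms 1–2 (largest-norm-prime forms, which would turn 1/2 into
a P-form) and the further cusp-field rows (X₀(9)/ℚ(√−3), X₀(25)/ℚ(ζ₅), X₁(10)/ℚ(√5)) are layer-2 /
sibling routes, not items here.

CHEAPEST FALSIFIER. (i) Dictionary (lookup + 10-line check, DONE): Δ(W(u,w)) = u⁵w⁵(u²−11uw−w²)
holds identically on 10 coprime pairs incl. (13,1) with 5 ∣ Q; gcd(c₄, uwQ) ∈ {1, 5}; Res(c₄(t),
t²−11t−1) = 25 — a prime p ≠ 5 with p ∣ uwQ, p ∤ N_W would kill D1 (none possible). (ii) Engine side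
condition (lookup in arXiv:2111.07791 §1: a, b, c ∈ 𝓞_K∖{0}, a+b+c = 0, pairwise coprime ideals):
the unit triple (x₊, φ⁵w, −u) is pairwise coprime for every coprime (u,w) (a common prime of two
members divides gcd(u,w)); the conjugate triples have common part dividing (√5)³ — bounded,
removable. (iii) Instrument ENG-T5-SZPIRO (kit j300264, PARI, this seat): all coprime |u| ≤ 250, 1 ≤
w ≤ 250: dictionary violations (expect 0), record Szpiro ratio on 𝒯₅, record log|Δ_min|/N^{1/2} (the
line predicts bounded; abc predicts → 0).

NUMBERS. All-E record exponent α = 1 (Murty–Pasten 2013: log|Δ| < 1.2 N log N + 93);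
Frey/full-2-torsion class 1/3 (Stewart–Yu 2001); rational-cusp pencils: ℤ/6 ↦ 1/4, ℤ/2×ℤ/6, X₀(12) ↦
1/6 (route-ABC-TwoSixPencil, class rows PROVED modulo Stewart–Yu in tree), k = 3 classes ↦ 1/3;
Gaussian 2-division sub-class 2/3 (open); one-rational-2-torsion class 3/4 (LINE 1, open,
conditional on K1a); THIS LINE: 1/2 on the 5-torsion class (2 rational + 2 conjugate cusps),
degraded reading 2/3. Integral slices w = ±1: exponent ε known (arXiv:2504.15971 Cor 1.2). Cusp
data: X₁(5) Hauptmodul t, E(t,t): y² + (1−t)xy − ty = x³ − tx², Δ = t⁵(t²−11t−1), c₄ =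
t⁴−12t³+14t²+12t+1, j = c₄³/Δ; cusp field ℚ(ζ₅)⁺ = ℚ(√5), h = 1, fundamental unit φ. Triple costs
(log_R G): (u,w,x±): 1+a+a′; (x₊,x₋,w): 2−2a; (x₊,x₋,u): 2−2a′ with rad u = R^a, rad w = R^{a′}; max
over (a,a′) of the min = 3/2 at a = a′ = 1/4 ⇒ exponent (1/3)(3/2) = 1/2.

DEFINITION REQUESTS. None at open. Wanted later (shared with route-ABC-GaussianTwoDivision): the
cite fact `Scoones2021_abcNumberField_cor` (arXiv:2111.07791 Thm 3 + final corollary; fixed number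
field K, Hilbert class field L, G over L) under Literature/NumberTheory/DiophantineGeometry, and a
small `QuadraticCuspForm` helper (the four cusp forms of X₁(5) over ℤ[φ] with their splitting lemma)
under Summits/ABC/ABC/Theorems.

Novelty: Searches (2026-08-28): lit search --hybrid "Szpiro ratio elliptic curves with rational 5-torsion
point discriminant conductor bound" (6 book hits: Silverman AEC/ATAEC, Evertse–Győry 2015 p.91,
Bombieri–Gubler, Cohen, Vojta — none on the class); lit search "Szpiro ratio torsion lower bound
Tate normal form" --source local (1: arXiv:2311.11266 p.6, Lehmer-type, unrelated); lit search
--hybrid "modified Szpiro ratio torsion subgroup family … Barrios" (books only); lit galaxy search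
"Szpiro ratio|torsion point of order 5|t^2-11t-1" --star all (8 panama hits, all noise:
schoolbooks); lit read arxiv:2504.15971 --grep Szpiro (Thm 1.1/Cor 1.2 read: INTEGER-parameter
families only); lit read arxiv:2111.07791 pp.3–4,7 (engine, hypotheses); tree: rg
"5-torsion|X₁(5)|u^2-11uw|cusp field|irrational cusp" over Summits/ABC + Ideas (hits:
LevelLoweredSzpiro l.124 mentions σ₅ growing along the 5-torsion family — lower-bound side only;
rational-cusp-pencil card: «k ≥ 3 RATIONAL cusps», ℤ/5 absent from its class list; no cusp-field
card); ledger negatives --problem ABC (2 entries, unrelated).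
Nearest prior art found: in-tree route-ABC-RationalCuspPencil / TwoSixPencil (rational cusps,
Stewart–Yu over ℚ, exponent 1/k) and route-ABC-GaussianTwoDivision (fixed ℚ(i) = 2-division field,
Scoones engine, 2/3) [tree]; print: Scoones arXiv:2111.07791 Thm 3 [corpus: paper-arxiv-2111.07791
p.4] (engine, no elliptic-curve classes), Cuevas Barrientos–Pasten arXiv:2504.15971 Thm 1.1 [corpus:
paper-arxiv-2504  [refs: 2311.11266, 2504.15971, 2111.07791, 2407.13850, 2104.10817, arxiv:2504.15971, arxiv:2111.07791, paper-arxiv-2111.07791, paper-arxiv-2504.15971]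

Barriers (technique_class: dictionary-import, baker-lfl-number-field, modular-units): - technique_class: dictionary-import, baker-lfl-number-field, modular-units
- Literature.Barriers.ABC.BakerMethodBounds: inside the class and respecting the cap — the output is
an exponential ε-shape (exponent 1/2 of the radical inside the exponential) on ONE class, never
polynomial abc and never below the G^{1/3} shape per triple; the gain over 1/3·(all-E) comes from
the density of G_K against rad over the cusp field, not from beating LFL
[Literature/Barriers/ABC/BakerMethodBounds.lean `BakerShapeBound`, `pasten2024_thm_1_4_1/2`; corpus:
Baker–Wüstholz 2007 pp.38–41].
- Literature.Barriers.ABC.BakerShapeConstantFloor: not engaged — κ is free (∃ κ), no explicit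
constant claimed; likewise the all-triples ε-shape members `EpsShapeBound θ₀` (θ₀ ≥ 1/3, module
BakerMethodBoundsEpsShape) quantify over ALL abc triples, while X1 quantifies over one binary form
(a 2-parameter class), where nothing below the all-triples 1/3 is claimed (1/2 > 1/3) and class
exponents 1/4, 1/6 are already in tree for other classes.
- Literature.Barriers.ABC.EpsilonCannotBeDropped: not engaged — every statement carries ε and free
constants; no ε = 0 or explicit-constant claim (same for ErdosWoodsTwoFails).
- B-RUNGE-PLACES (planner note, this seat g2): not engaged — no Runge/integrality-of-j step; the
cusps are used through Tate's algorithm (bad reduction), not through integral points.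
- B-TORSION-FIELD-COST (planner note, this seat g2: ℓ-division fields cost |d_L|^{1/2} ≥ rad^{≥2}
for ℓ ≥ 3): evaded — th

Novelty grade: new-combination — new-combination (critic abc-iut-crit-B, PRIMARY on abc-idea-2; verdict PASS-WITH-PRICE class record 2026-08-28T06:3xZ). Load-bearing levers EACH already used on this problem: (a) cusp-form pencils of a genus-0 modular curve fed to a Stewart–Yu-type bound — RationalCuspPencil / TwoSixPencil (rational (refuter refuter-abc-iut-crit-B-g1-0, 2026-08-28T06:18:17Z; prior: Summit.ABC.ABC.Theses.RationalCuspPencil.PencilFourBound (stmt-ABC-24549, proved: pencilFourBound_proof) — cusp-form pencils with k ≥ 3 rational cusps; ℤ/5 listed as 'k = 2, no statement', Summit.ABC.ABC.Theses.TwoSixPencil.PencilBound (stmt-ABC-24782, proved), Summit.ABC.ABC.Theses.GaussianTwoDivision.GaussianNormTripleBound (stmt-ABC-23401, open) — number-field Stewart–Yu/Scoones over a fixed cl)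

History (route lifecycle, newest last):
- 2026-08-28T06:28:17Z · rev 1: dropped stmt-ABC-26206 — drop the unrendered duplicate wanted-item 26206 (NFPencilBound added via workitem add, never rendered into the file); the same statement is re-filed properly as (planner-abc-idea-2-g2-0)
- 2026-08-28T06:55:42Z · rev 3: informal re-worded for NFPencilBound (planner-abc-idea-2-g2-0)

sub-problem: ABC · status: draft · opened planner-abc-idea-2-g2-0 2026-08-28T06:11:40Z · rev 3 · ledger route-ABC-CuspFieldPencil
GENERATED by the gate from the ledger (D-0016/17). Provers cite these decls: `theorem foo : Summit.ABC.ABC.Theses.CuspFieldPencil.<Decl> := …` in Summits/ABC/ABC/Theorems/<Name>.lean.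
-/

namespace Summit.ABC.ABC.Theses.CuspFieldPencil

open scoped BigOperators Topology Manifold Classical MeasureTheory ProbabilityTheory Matrix InnerProductSpace ComplexConjugate ContinuousMap
open Filter Set Function TopologicalSpace MeasureTheory

attribute [summit_statement] _root_.ABC

open Literature.Abc

/-! Retired items kept as plain definitions (history; not obligations of this route): landed proofs / closed glue still name them. -/

/-- retired stmt-ABC-26250 (moot, gen 1) — named by an active item. -/
def NFPencilBound : Prop :=
  ∀ (K : Type) [Field K] [NumberField K], IsPrincipalIdealRing (NumberField.RingOfIntegers K) → ∀ (k : ℕ) (α β : Fin k → NumberField.RingOfIntegers K), 3 ≤ k → (∀ i j, i ≠ j → α i * β j ≠ α j * β i) → ∀ ε : ℝ, 0 < ε → ∃ C : ℝ, ∀ u w : ℤ, IsCoprime u w → (∏ i, (α i * (u : NumberField.RingOfIntegers K) + β i * (w : NumberField.RingOfIntegers K))) ≠ 0 → Real.log ((max |u| |w| : ℤ) : ℝ) ≤ C * ((∏ i, Ideal.absNorm (Ideal.span {α i * (u : NumberField.RingOfIntegers K) + β i * (w : NumberField.RingOfIntegers K)}).radical : ℕ) : ℝ) ^ (1 / (k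 : ℝ) + ε)

/-- item stmt-ABC-26025 · target · rank 0 · open · by planner
why it might fail: it fails only if X1 fails; abc (indeed Szpiro with any exponent) implies it, so falsity would refute abc on 𝒯₅ — the risk is that the cusp-field engine delivers only 2/3 (conjugate-cusp triples unusable), not falsity.
sources: arXiv:2111.07791, arXiv:2407.13850, MurtyPasten2013
[target] for every ε > 0 there is C such that for all coprime integers u, w with uw(u²−11uw−w²) ≠ 0
and every elliptic W/ℚ equal to ⟨w−u, −uw, −uw², 0, 0⟩: log|Δ_min(W)| ≤ C·N_W^{1/2+ε}. A class
theorem on the rational-5-torsion class (NOT abc, NOT A-PS, NOT the all-E rung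
SzpiroExponentBelowOne). -/
@[route_item "route-ABC-CuspFieldPencil"]
def FiveTorsionClassEpsShape : Prop :=
  ∀ ε : ℝ, 0 < ε → ∃ C : ℝ, ∀ u w : ℤ, IsCoprime u w → u * w * (u ^ 2 - 11 * u * w - w ^ 2) ≠ 0 → ∀ (W : WeierstrassCurve ℚ) [W.IsElliptic], W = ⟨((w : ℚ) - (u : ℚ)), (-((u : ℚ) * (w : ℚ))), (-((u : ℚ) * (w : ℚ) ^ 2)), 0, 0⟩ → Real.log (W.minimalDiscriminantNorm ℤ : ℝ) ≤ C * (W.conductorNorm ℤ : ℝ) ^ (1 / 2 + ε : ℝ)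

/-- item stmt-ABC-26026 · crux · rank 2 · closed · proved by Summit.ABC.ABC.Theorems.goldenCuspShadow_proof (planner) · by planner
why it might fail: Scoones' corollary wants pairwise-coprime 𝓞_K-triples under her relabeling; the conjugate-cusp triples (x₊, x₋, 5√5·w) share √5 when 5 ∣ Q and carry the constant 5√5 — if only the unit-coefficient triples (u, φ⁵w, x₊) qualify, the exponent degrades to 2/3 (not to nothing).
sources: arXiv:2111.07791, StewartYu2001, EvertseGyory2015, Kubert1976
retired/moot children: NFPencilBound [moot: ∀ (K : Type) [Field K] [NumberField K], IsPrincipalIdealRing (NumberField.RingOf]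
[crux] X1, the ℤ-shadow of Scoones' number-field Stewart–Yu over the cusp field ℚ(√5) run on the
three cusp triples of X₁(5) and minimised: for every ε > 0 there is κ with log max(|u|,|w|) ≤ κ ·
rad(u·w·(u²−11uw−w²))^{1/2+ε} for all coprime integers u, w with uw(u²−11uw−w²) ≠ 0 — abc with
exponent 1/2 inside the exponential for ONE binary quartic form, the norm form of the cusps of
X₁(5). [difficulty: L] -/
@[route_item "route-ABC-CuspFieldPencil", crux]
def GoldenCuspShadow : Prop :=
  ∀ ε : ℝ, 0 < ε → ∃ κ : ℝ, ∀ u w : ℤ, IsCoprime u w → u * w * (u ^ 2 - 11 * u * w - w ^ 2) ≠ 0 → Real.log (max (|(u : ℝ)|) (|(w : ℝ)|)) ≤ κ * (((UniqueFactorizationMonoid.radical (u * w * (u ^ 2 - 11 * u * w - w ^ 2))).natAbs : ℕ) : ℝ) ^ (1 / 2 + ε : ℝ)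

-- `GoldenCuspShadow` holds: proved by `Summit.ABC.ABC.Theorems.goldenCuspShadow_proof` (its module imports this route file, so no `_holds` link can be stated here).

-- parent: GoldenCuspShadow · child (gen 1)
/--     item stmt-ABC-26251 · support · rank 202 · closed · proved by Summit.ABC.ABC.Theorems.goldenFromNFPencil_proof (prover)
    parent: GoldenCuspShadow · by planner
    why it might fail: only formalisation cost: a NumberField instance for ℚ(√5) with 𝓞 = ℤ[φ] a PID, and Ideal.absNorm computations for rational integers in it.
    sources: arXiv:2111.07791, stmt-ABC-24782
THE GOLDEN INSTANCE (support, bookkeeping): NFPencilBound at K = ℚ(√5) (h_K = 1), k = 4, forms u, w,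
u − φ⁵w, u + φ⁻⁵w (φ⁵ = (11+5√5)/2; pairwise non-proportional; product u·w·(u²−11uw−w²)) gives
GoldenCuspShadow: ∏G_i ≤ 5²·rad(u)²rad(w)²rad(u²−11uw−w²)² ≤ 25·rad(uw(u²−11uw−w²))² (rational u, w
cost p² per prime in 𝓞_K: inert N = p², split both conjugates divide; the conjugate pair costs
rad(Q)² jointly: split p | Q gives one norm-p prime on each side, inert p ∤ Q for coprime u,w since
Q ≡ (u−3w)² − 5w²·… has only split/ramified prime divisors, 5 ramified) so (∏G_i)^{1/4+ε} ≤
5·rad^{1/2+2ε}. Needs a Lean model of ℚ(√5) with IsPrincipalIdealRing 𝓞 (class number one: Mathlib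
has the Minkowski-bound route) — the one non-trivial formal step. -/
@[route_item "route-ABC-CuspFieldPencil"]
def GoldenFromNFPencil : Prop :=
  NFPencilBound → GoldenCuspShadow

-- `GoldenFromNFPencil` holds: proved by `Summit.ABC.ABC.Theorems.goldenFromNFPencil_proof` (its module imports this route file, so no `_holds` link can be stated here).

-- parent: GoldenCuspShadow · glue (gen 1)
/--     item stmt-ABC-26252 · support · rank 203 · closed · proved by Summit.ABC.ABC.Theorems.goldenCuspShadowGlue_proof (prover)
    parent: GoldenCuspShadow · GLUE: children ⟹ parent · by planner
NFPencilBound → GoldenFromNFPencil → GoldenCuspShadow: modus ponens — the parametric number-field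
pencil theorem (filed once, with the level TABLE) specialised to the golden instance K = ℚ(√5), k =
4; the parent stays claimable directly. -/
@[route_item "route-ABC-CuspFieldPencil"]
def GoldenCuspShadowGlue : Prop :=
  NFPencilBound → GoldenFromNFPencil → GoldenCuspShadow

-- `GoldenCuspShadowGlue` holds: proved by `Summit.ABC.ABC.Theorems.goldenCuspShadowGlue_proof` (its module imports this route file, so no `_holds` link can be stated here).

/-- item stmt-ABC-26027 · crux · rank 3 · open · by planner
why it might fail: it is abc-hard (equivalent to abc given the class theorem); it fails exactly if abc fails — declared residual, not a claim of this line.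
sources: PastenShimura2024, Literature.Abc.ABCConjecture
[crux] DECLARED RESIDUAL (abc-strength by construction, never staffed as mathematics of this line):
abc given the class theorem on 𝒯₅. Booked so that `closes` reaches the registered Statement decl; to
be narrowed by name to any registered all-E rung the class theorem feeds (none exists today:
`SzpiroExponentBelowOne` is not a registered closer). [deps: FiveTorsionClassEpsShape] [difficulty:
open-problem] -/
@[route_item "route-ABC-CuspFieldPencil", crux]
def FiveTorsionResidual : Prop :=
  FiveTorsionClassEpsShape → _root_.ABC

/-- item stmt-ABC-26028 · support · rank 9 · closed · proved by Summit.ABC.ABC.Theorems.fiveTorsionDictionary_proof (prover) · by planner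
sources: Silverman2009, Kubert1976, stmt-ABC-23398
[support] for coprime u, w with uw(u²−11uw−w²) ≠ 0 and W = ⟨w−u, −uw, −uw², 0, 0⟩ elliptic:
|Δ_min(W)| ≤ |u⁵w⁵(u²−11uw−w²)| (W is an integral model and Δ(W) = u⁵w⁵(u²−11uw−w²) identically —
checked symbolically/numerically) and rad(u·w·(u²−11uw−w²)) ∣ 5·N_W (for p ≠ 5 dividing a cusp form,
p ∤ c₄(W) = u⁴−12u³w+14u²w²+12uw³+w⁴ since c₄ ≡ w⁴ mod u, ≡ u⁴ mod w and Res_t(c₄, t²−11t−1) = 25;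
so W is p-minimal with multiplicative reduction — Tate's algorithm, pattern of
`twoTorsionDictionary_proof` / `RationalCuspPencilSixTorsionDictionary`). [difficulty: provable-now] -/
@[route_item "route-ABC-CuspFieldPencil", crux]
def FiveTorsionDictionary : Prop :=
  ∀ u w : ℤ, IsCoprime u w → u * w * (u ^ 2 - 11 * u * w - w ^ 2) ≠ 0 → ∀ (W : WeierstrassCurve ℚ) [W.IsElliptic], W = ⟨((w : ℚ) - (u : ℚ)), (-((u : ℚ) * (w : ℚ))), (-((u : ℚ) * (w : ℚ) ^ 2)), 0, 0⟩ → (W.minimalDiscriminantNorm ℤ : ℝ) ≤ |(u : ℝ) ^ 5 * (w : ℝ) ^ 5 * ((u : ℝ) ^ 2 - 11 * (u : ℝ) * (w : ℝ) - (w : ℝ) ^ 2)| ∧ (UniqueFactorizationMonoid.radical (u * w * (u ^ 2 - 11 * u * w - w ^ 2))).natAbs ∣ 5 * W.conductorNorm ℤ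

-- `FiveTorsionDictionary` holds: proved by `Summit.ABC.ABC.Theorems.fiveTorsionDictionary_proof` (its module imports this route file, so no `_holds` link can be stated here).

/-- item stmt-ABC-26029 · support · rank 9 · closed · proved by Summit.ABC.ABC.Theorems.fiveTorsionPayoff_proof (prover) · by planner
sources: Silverman2009, stmt-ABC-23398
[support] X1 + dictionary ⇒ target: log|Δ_min| ≤ log|u⁵w⁵Q| ≤ 12·log max(|u|,|w|) + log 13 ≤
12κ·rad(uwQ)^{1/2+ε} + log 13 ≤ 12κ·(5N)^{1/2+ε} + log 13 ≤ C·N^{1/2+ε} (N ≥ 1; real arithmetic with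
Real.log / rpow monotonicity, Nat casts of the divisibility rad ∣ 5N). [difficulty: provable-now] -/
@[route_item "route-ABC-CuspFieldPencil", crux]
def FiveTorsionPayoff : Prop :=
  GoldenCuspShadow → FiveTorsionDictionary → FiveTorsionClassEpsShape

-- `FiveTorsionPayoff` holds: proved by `Summit.ABC.ABC.Theorems.fiveTorsionPayoff_proof` (its module imports this route file, so no `_holds` link can be stated here).

/-- item stmt-ABC-26030 · assembly · rank 1 · open · by planner
sources: arXiv:2111.07791
[assembly] X1 → dictionary → payoff → residual → abc. -/
@[route_item "route-ABC-CuspFieldPencil"]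
def Assembly : Prop :=
  GoldenCuspShadow → FiveTorsionDictionary → FiveTorsionPayoff → FiveTorsionResidual → _root_.ABC

/-! D-0027 §2.1 — DECIDING THEOREM (planner-authored via `route open/edit --closes-file`; by planner-abc-idea-2-g2-0 2026-08-28T06:11:40Z):
its hypotheses are this route's items and its conclusion the sub-problem Statement (glue_lint), and it elaborates with this file. -/

@[closes "route-ABC-CuspFieldPencil"] theorem closes (h₁ : GoldenCuspShadow) (h₂ : FiveTorsionDictionary) (h₃ : FiveTorsionPayoff)
    (h₄ : FiveTorsionResidual) : _root_.ABC := h₄ (h₃ h₁ h₂)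

end Summit.ABC.ABC.Theses.CuspFieldPencil
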